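import Mathlib
import HarnessLib
import Summits.Ventures.LatticeQCDFlow.Scaling.AR1SwitchingLaw

/-!
# SweepAllocationLaw — at a fixed budget of relaxation sweeps, spread them over as many protocol
# steps as possible: `m ↦ m·k′(ρ^m)` is non-decreasing (`k′(ρ) = Δ²(1+ρ)/(1−ρ)` the AR(1) /
# `2τ_int` constant), so `−log ESS = k′(ρ^m)·m·N/T` is minimised by ONE sweep per step

HONEST FRAMING: exact (Metropolis-corrected) sampling algorithms for lattice gauge theory;
figures of merit are autocorrelation/cost numbers at stated couplings and volumes; no
continuum-physics claim.

Venture `LatticeQCDFlow` (cell pub-lqcd), topic `Scaling`; FANOUT row 19 (`su2-snf`, GEN-6: levers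
`protocol.n_step` and `protocol.n_relax` = relaxation sweeps per step, registry `lqcd-flow/levers@1.2`).
OUR WORK, elementary; nothing is cited as a fact.
Setting: the exactly solvable AR(1) switching model of `Scaling/AR1SwitchingLaw` (row 19 GEN-4),
`−log ESS = k′(ρ)·N/n` with `k′(ρ) = kPrime Δ ρ = Δ²(1+ρ)/(1−ρ)` for ONE layer of autocorrelation
`ρ` per protocol step; `m` layers per step compose to autocorrelation `ρ^m` (and, for the certified
envelopes of `Scaling/ChiSqContraction`, `m` sweeps `χ²`-contract with `ρ^m`, `ChiSqContracts.pow`).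
With a budget of `T = n·m` layer applications the exponent is `k′(ρ^m)·N/n = [m·k′(ρ^m)]·N/T`.

* `key_sweep_ineq` — `(2m+1)·q^m·(1 − q) ≤ 1 − q^{2m+1}` (AM–GM on the pairs `q^{m−k} + q^{m+k}`,
  proved by induction);
* **`sweepFactor_le_succ`, `sweepFactor_mono`** — `f(m) = m(1 + q^m)/(1 − q^m)` is non-decreasing
  in `m ∈ ℕ` for `0 ≤ q < 1` (the identity
  `(m+1)(1+q^{m+1})(1−q^m) − m(1+q^m)(1−q^{m+1}) = 1 − q^{2m+1} − (2m+1)q^m(1−q) ≥ 0`);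
* **`mul_kPrime_pow_mono` — THE SWEEP-ALLOCATION LAW**: `m ↦ m·kPrime Δ (ρ^m)` is non-decreasing
  (`0 ≤ ρ < 1`); `kPrime_le_mul_kPrime_pow` — in particular `kPrime Δ ρ ≤ m·kPrime Δ (ρ^m)` for
  `m ≥ 1`: at fixed total work `T`, one layer per step (`m = 1`, `n = T`) minimises
  `−log ESS = m·k′(ρ^m)·N/T`; doubling the relaxation per step never pays for the halved step count
  (equality only in the limit `ρ → 1`, where `m·k′(ρ^m) → 2Δ²/(−log ρ)·(1 + O(m² log²ρ))`).

Reading (value-free): in the model behind E7's law the Jarzynski exponent per unit of relaxation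
work is best when the protocol is refined rather than the relaxation deepened; the certified
finite-`n` floor constant of `Scaling/ESSFloorCostEnvelope` only adds factors `e^{ΔD/n}`, `e^{3ΔD/n}`
that grow when `n` is reduced, i.e. point the same way.  NOT CLAIMED: that a lattice heat-bath /
over-relaxation sweep is an AR(1) layer; per-step overheads other than the layers (a fixed cost per
step shifts the optimum to `m > 1` — that trade-off is `Scaling/NonEquilibriumOverhead`).
-/

namespace Summit.Ventures.LatticeQCDFlow.Scaling

/-- **`(2m+1)·q^m·(1 − q) ≤ 1 − q^{2m+1}`** (`0 ≤ q ≤ 1`): `Σ_{j=0}^{2m} q^j ≥ (2m+1) q^m` by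
AM–GM on the pairs `q^{m−k} + q^{m+k} ≥ 2q^m`; here by induction on `m`. -/
theorem key_sweep_ineq {q : ℝ} (hq0 : 0 ≤ q) (hq1 : q ≤ 1) :
    ∀ m : ℕ, (2 * m + 1) * q ^ m * (1 - q) ≤ 1 - q ^ (2 * m + 1)
  | 0 => by simp
  | m + 1 => by
    have ih := key_sweep_ineq hq0 hq1 m
    have hqm0 : 0 ≤ q ^ m := pow_nonneg hq0 m
    have hqm : q ^ m ≤ 1 := pow_le_one₀ hq0 hq1
    -- Bernoulli: `1 − q^j ≤ j(1 − q)` (Mathlib's `one_add_mul_le_pow` with `a = q − 1`)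
    have hB : ∀ j : ℕ, 1 - q ^ j ≤ j * (1 - q) := by
      intro j
      have h := one_add_mul_le_pow (by linarith : (-2 : ℝ) ≤ q - 1) j
      rw [show 1 + (q - 1) = q by ring] at h
      linarith
    have h1 := hB m
    have h2 := hB (m + 1)
    -- `2 − q^m − q^{m+1} ≤ (2m+1)(1−q)` and `q^{m+1} ≤ q^m`
    have hA : 2 - q ^ m - q ^ (m + 1) ≤ (2 * m + 1) * (1 - q) := by
      push_cast at h1 h2 ⊢; linarith
    have hB : q ^ (m + 1) ≤ q ^ m := by
      rw [pow_succ]; exact mul_le_of_le_one_right hqm0 hq1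
    have hq1' : 0 ≤ 1 - q := sub_nonneg.mpr hq1
    have hqm1 : 0 ≤ q ^ (m + 1) := pow_nonneg hq0 _
    -- the increment R(m+1) − R(m) = (1−q)[(2m+1)q^m(1−q) − q^{m+1}(2 − q^m − q^{m+1})] ≥ 0
    have e1 : q ^ (2 * (m + 1) + 1) = q ^ (2 * m + 1) * q * q := by
      rw [show 2 * (m + 1) + 1 = 2 * m + 1 + 1 + 1 by ring, pow_succ, pow_succ]
    have e2 : q ^ (2 * m + 1) = q ^ m * q ^ (m + 1) := by
      rw [← pow_add]; congr 1; ring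
    have e3 : q ^ (m + 1) = q ^ m * q := pow_succ q m
    rw [e1, e2, e3]
    rw [e2, e3] at ih
    rw [e3] at hA hB
    push_cast
    have hC : q ^ m * q * (2 - q ^ m - q ^ m * q) ≤ q ^ m * ((2 * m + 1) * (1 - q)) := by
      calc q ^ m * q * (2 - q ^ m - q ^ m * q)
          ≤ q ^ m * q * ((2 * m + 1) * (1 - q)) :=
            mul_le_mul_of_nonneg_left hA (by positivity)
        _ ≤ q ^ m * ((2 * m + 1) * (1 - q)) := by
            have : 0 ≤ (2 * (m : ℝ) + 1) * (1 - q) := by positivity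
            nlinarith [mul_le_mul_of_nonneg_right hB this]
    nlinarith [hC, hq1', hqm0, hq0, mul_nonneg hqm0 hq0]

/-- The sweep factor `f(m) = m(1 + q^m)/(1 − q^m)`: `m·k′(ρ^m) = Δ²·f(m)` at `q = ρ`. -/
noncomputable def sweepFactor (q : ℝ) (m : ℕ) : ℝ := m * (1 + q ^ m) / (1 - q ^ m)

/-- **One more sweep per step never lowers the factor**: `f(m) ≤ f(m+1)` (`0 ≤ q < 1`). -/
theorem sweepFactor_le_succ {q : ℝ} (hq0 : 0 ≤ q) (hq1 : q < 1) (m : ℕ) :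
    sweepFactor q m ≤ sweepFactor q (m + 1) := by
  unfold sweepFactor
  rcases Nat.eq_zero_or_pos m with rfl | hm
  · simp only [Nat.cast_zero, zero_mul, zero_div, zero_add, pow_one, Nat.cast_one, one_mul]
    exact div_nonneg (by linarith) (by linarith)
  have hqm : q ^ m < 1 := pow_lt_one₀ hq0 hq1 (Nat.pos_iff_ne_zero.mp hm)
  have hqm1 : q ^ (m + 1) < 1 := pow_lt_one₀ hq0 hq1 (Nat.succ_ne_zero m)
  have hd : 0 < 1 - q ^ m := by linarith
  have hd1 : 0 < 1 - q ^ (m + 1) := by linarith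
  rw [div_le_div_iff₀ hd hd1]
  have key := key_sweep_ineq hq0 hq1.le m
  -- the identity (m+1)(1+q^{m+1})(1−q^m) − m(1+q^m)(1−q^{m+1}) = 1 − q^{2m+1} − (2m+1)q^m(1−q)
  have e2 : q ^ (2 * m + 1) = q ^ m * q ^ (m + 1) := by rw [← pow_add]; congr 1; ring
  have e3 : q ^ (m + 1) = q ^ m * q := pow_succ q m
  rw [e2, e3] at key
  rw [e3]
  push_cast
  nlinarith [key]

/-- `f` is non-decreasing on `ℕ`. -/
theorem sweepFactor_mono {q : ℝ} (hq0 : 0 ≤ q) (hq1 : q < 1) : Monotone (sweepFactor q) :=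
  monotone_nat_of_le_succ (sweepFactor_le_succ hq0 hq1)

/-- `m·k′(ρ^m) = Δ²·f(m)`. -/
theorem mul_kPrime_pow_eq (Δ ρ : ℝ) (m : ℕ) :
    (m : ℝ) * kPrime Δ (ρ ^ m) = Δ ^ 2 * sweepFactor ρ m := by
  unfold kPrime sweepFactor
  ring

/-- **THE SWEEP-ALLOCATION LAW.**  For `0 ≤ ρ < 1` the map `m ↦ m·kPrime Δ (ρ^m)` is non-decreasing:
in the AR(1) switching model, at a fixed budget `T = n·m` of layer applications the Jarzynski
exponent `−log ESS = k′(ρ^m)·N/n = [m·k′(ρ^m)]·N/T` is smallest with ONE layer per protocol step. -/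
theorem mul_kPrime_pow_mono (Δ : ℝ) {ρ : ℝ} (hρ0 : 0 ≤ ρ) (hρ1 : ρ < 1) :
    Monotone (fun m : ℕ => (m : ℝ) * kPrime Δ (ρ ^ m)) := by
  intro m m' h
  simp only [mul_kPrime_pow_eq]
  exact mul_le_mul_of_nonneg_left (sweepFactor_mono hρ0 hρ1 h) (sq_nonneg Δ)

/-- In particular `k′(ρ) ≤ m·k′(ρ^m)` for every `m ≥ 1`: deepening the relaxation per step by a
factor `m` (at `m` times fewer steps) never lowers the exponent. -/
theorem kPrime_le_mul_kPrime_pow (Δ : ℝ) {ρ : ℝ} (hρ0 : 0 ≤ ρ) (hρ1 : ρ < 1) {m : ℕ} (hm : 1 ≤ m) :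
    kPrime Δ ρ ≤ (m : ℝ) * kPrime Δ (ρ ^ m) := by
  have h := mul_kPrime_pow_mono Δ hρ0 hρ1 hm
  simpa using h

/-- The same at the level of the ESS law: with `n = T/m` steps of `m` layers,
`exp(−k′(ρ)·N/T) ≥ exp(−k′(ρ^m)·N/(T/m))` (`N ≥ 0`, `T > 0`, `m ≥ 1`) — the one-layer-per-step
schedule has the largest model ESS at every budget. -/
theorem exp_neg_kPrime_budget_ge (Δ : ℝ) {ρ N T : ℝ} (hρ0 : 0 ≤ ρ) (hρ1 : ρ < 1) (hN : 0 ≤ N)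
    (hT : 0 < T) {m : ℕ} (hm : 1 ≤ m) :
    Real.exp (-(kPrime Δ (ρ ^ m) * N / (T / m))) ≤ Real.exp (-(kPrime Δ ρ * N / T)) := by
  have h := kPrime_le_mul_kPrime_pow Δ hρ0 hρ1 hm
  have hm0 : (0 : ℝ) < m := by exact_mod_cast hm
  rw [Real.exp_le_exp, neg_le_neg_iff, div_div_eq_mul_div,
    show kPrime Δ (ρ ^ m) * N * m / T = (m * kPrime Δ (ρ ^ m)) * N / T by ring]
  exact div_le_div_of_nonneg_right (mul_le_mul_of_nonneg_right h hN) hT.le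

end Summit.Ventures.LatticeQCDFlow.Scaling
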